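import Literature.NumberTheory.Automorphic.LocalComponentBJSatakeProofs
import Literature.NumberTheory.Automorphic.LocalComponentBJUnramifiedProofs
import HarnessLib

/-!
# Satake parameters of `π` at `v` ARE the Satake parameters of a spherical local component

Topic `Literature/NumberTheory/Automorphic`; proof file (theorems only: no definition, no named
fact, no instance).  Companion of `LocalComponentBJSatakeProofs`
(`CuspidalAutomorphicRepData.isSatakeParameter_of_hasLocalComponentAt`: a Satake parameter of the
cuspidal Borel–Jacquet datum `π` at `v` is a local Satake parameter of every irreducible smooth
local component `π_v`) and `LocalComponentBJUnramifiedProofs`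
(`isUnramifiedAt_of_hasLocalComponentAt_of_mem_fixedPoints`: a spherical local component makes `π`
unramified at `v`).  We record the resulting EQUIVALENCE
(`hasSatakeParamAt_iff_isSatakeParameter_of_hasLocalComponentAt`): for a cuspidal `π` on
`GL_n(𝔸_K)` (`n ≥ 1`) with an irreducible smooth local component `π_v` possessing a non-zero
`GL_n(𝒪_v)`-fixed vector, and any uniformiser `ϖ'` of `K_v`,

`π.HasSatakeParamAt v β ↔ IsSatakeParameter π_v ϖ' β`

— the unramified local–global dictionary of Flath 1979, Thm. 3 / Borel–Jacquet 1979, §4.6 in both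
directions (the converse uses the uniqueness of local Satake parameters of an irreducible
admissible spherical representation, `SatakeParametersGL.existsUnique_isSatakeParameter_holds`, and
Jacquet's admissibility theorem `jacquetAdmissibility_gl_holds`), together with the
identification of the two `GL_n(𝒪_v)`'s of the tree (`glInt n K_v` of `ReductiveGroupData` and
`valuedCongruenceSubgroup (Fin n) 1` of `GLnAdelicStructure`),
`mem_glInt_iff_mem_valuedCongruenceSubgroup_one` (asked for in `GLnAdelicStructure`, outline D2).
In particular `π` unramified at `v` with local component `π_v` spherical determines the local
Euler factor `∏_{b ∈ β} (1 - b q_v^{-s})⁻¹` from either side — the input "(U)/(G)" of the standard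
`L`-function theory of cuspidal `GL(2)` (`JacquetLanglands1970_standardLTheoryGL2`).

## References

* D. Flath, *Decomposition of representations into tensor products*, Corvallis 1979, Thm. 3.
  [FlathCorvallis1979]
* A. Borel, H. Jacquet, *Automorphic forms and automorphic representations*, Corvallis 1979,
  §4.6. [BorelJacquetCorvallis1979]
* P. Cartier, *Representations of p-adic groups*, Corvallis 1979, §IV.4. [CartierCorvallis1979]
-/

noncomputable section

open scoped MatrixGroups Classical
open NumberField IsDedekindDomain

namespace Literature.NumberTheory.Automorphic

variable {n : ℕ} {K : Type} [Field K] [NumberField K] {hcpt : isCompact_glFiniteIntegralLevel n K}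

/-- **The two `GL_n(𝒪_v)`'s agree**: the accepted `glInt n K_v` (`ValuativeRel` integers of the
entries of `g`, `g⁻¹`) is the valued congruence subgroup of radius `1` (`Valued.v ≤ 1`), the
identification asked for in `GLnAdelicStructure` (outline D2). [folklore] -/
theorem mem_glInt_iff_mem_valuedCongruenceSubgroup_one {v : HeightOneSpectrum (𝓞 K)}
    (g : GL (Fin n) (v.adicCompletion K)) :
    g ∈ glInt n (v.adicCompletion K) ↔
      g ∈ valuedCongruenceSubgroup (Fin n) (1 : WithZero (Multiplicative ℤ)) := by
  rw [mem_glInt_iff, mem_valuedCongruenceSubgroup_iff]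
  constructor
  · rintro ⟨h1, h2⟩
    refine ⟨fun i j => (mem_integer_adicCompletion_iff K v).1 (h1 i j),
      fun i j => (mem_integer_adicCompletion_iff K v).1 (h2 i j), fun i j => ?_⟩
    rw [Matrix.sub_apply]
    refine (Valuation.map_sub _ _ _).trans
      (max_le ((mem_integer_adicCompletion_iff K v).1 (h1 i j)) ?_)
    rw [Matrix.one_apply]
    split_ifs <;> simp
  · rintro ⟨h1, h2, -⟩
    exact ⟨fun i j => (mem_integer_adicCompletion_iff K v).2 (h1 i j),
      fun i j => (mem_integer_adicCompletion_iff K v).2 (h2 i j)⟩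

/-- **From `map (𝒪_v ↪ K_v)`-invariance to `glInt`-invariance**: a vector fixed by the image of
`GL_n(𝒪_v)` under `GeneralLinearGroup.map` (the spelling of
`hasLocalComponentAt_spherical_of_hasSatakeParamAt`) is fixed by `glInt n K_v` (the spelling of
`IsSatakeParameter` and of the local `L`-factor theorems): an element of `glInt` has integral
entries, hence comes from an invertible matrix over `𝒪_v`. [folklore] -/
theorem mem_fixedPoints_glInt_of_forall_map_subtype {v : HeightOneSpectrum (𝓞 K)}
    {V : Type*} [AddCommGroup V] [Module ℂ V]
    (ρ : Representation ℂ (GL (Fin n) (v.adicCompletion K)) V) {x₀ : V}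
    (hfix : ∀ g ∈ (Matrix.GeneralLinearGroup.map
        ((v.adicCompletionIntegers K).subtype :
          v.adicCompletionIntegers K →+* v.adicCompletion K)).range, ρ g x₀ = x₀) :
    x₀ ∈ ρ.fixedPoints (glInt n (v.adicCompletion K)) := by
  rw [Representation.mem_fixedPoints]
  intro k hk
  obtain ⟨h₁, h₂, -⟩ := (mem_glInt_iff_mem_valuedCongruenceSubgroup_one k).1 hk
  have hmem : ∀ i j, (k : Matrix (Fin n) (Fin n) (v.adicCompletion K)) i j ∈
      v.adicCompletionIntegers K := fun i j =>
    (HeightOneSpectrum.mem_adicCompletionIntegers (R := 𝓞 K) K v).mpr (h₁ i j)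
  have hmem' : ∀ i j, ((k⁻¹ : GL (Fin n) (v.adicCompletion K)) :
      Matrix (Fin n) (Fin n) (v.adicCompletion K)) i j ∈ v.adicCompletionIntegers K := fun i j =>
    (HeightOneSpectrum.mem_adicCompletionIntegers (R := 𝓞 K) K v).mpr (h₂ i j)
  let A : Matrix (Fin n) (Fin n) (v.adicCompletionIntegers K) := fun i j => ⟨_, hmem i j⟩
  let B : Matrix (Fin n) (Fin n) (v.adicCompletionIntegers K) := fun i j => ⟨_, hmem' i j⟩
  have hA : A.map (v.adicCompletionIntegers K).subtype =
      (k : Matrix (Fin n) (Fin n) (v.adicCompletion K)) := rfl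
  have hB : B.map (v.adicCompletionIntegers K).subtype =
      ((k⁻¹ : GL (Fin n) (v.adicCompletion K)) : Matrix (Fin n) (Fin n) (v.adicCompletion K)) := rfl
  have hinj : Function.Injective (fun M : Matrix (Fin n) (Fin n) (v.adicCompletionIntegers K) =>
      M.map (v.adicCompletionIntegers K).subtype) :=
    Matrix.map_injective Subtype.val_injective
  have hAB : A * B = 1 := by
    apply hinj
    change (A * B).map _ = (1 : Matrix _ _ _).map _
    rw [Matrix.map_mul, hA, hB, Matrix.map_one _ (map_zero _) (map_one _), ← Units.val_mul,
      mul_inv_cancel, Units.val_one]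
  have hBA : B * A = 1 := by
    apply hinj
    change (B * A).map _ = (1 : Matrix _ _ _).map _
    rw [Matrix.map_mul, hA, hB, Matrix.map_one _ (map_zero _) (map_one _), ← Units.val_mul,
      inv_mul_cancel, Units.val_one]
  let u : GL (Fin n) (v.adicCompletionIntegers K) := ⟨A, B, hAB, hBA⟩
  have hu : Matrix.GeneralLinearGroup.map (v.adicCompletionIntegers K).subtype u = k :=
    Units.ext hA
  rw [← hu]
  exact hfix _ ⟨u, rfl⟩

/-- **Unramified ⟹ spherical, `glInt` form**: if `π` has a Satake parameter at `v` and `π_v` is an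
irreducible smooth local component, then `π_v` has a non-zero `glInt n K_v`-fixed vector
(`hasLocalComponentAt_spherical_of_hasSatakeParamAt_holds` + the bridge above).
[cite: FlathCorvallis1979, Thm. 3] [cite: BorelJacquetCorvallis1979, §4.6] -/
theorem exists_mem_fixedPoints_glInt_of_isUnramifiedAt
    (π : AutomorphicRepData (AutomorphyDatum.gl n K hcpt)) (v : HeightOneSpectrum (𝓞 K))
    (hπ : π.IsUnramifiedAt v)
    (πv : SmoothIrrep (GL (Fin n) (v.adicCompletion K))) (hloc : π.HasLocalComponentAt v πv.ρ) :
    ∃ x₀ : πv.V, x₀ ≠ 0 ∧ x₀ ∈ πv.ρ.fixedPoints (glInt n (v.adicCompletion K)) := by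
  obtain ⟨β, hβ⟩ := hπ
  obtain ⟨x₀, hx₀, hfix⟩ :=
    AutomorphicRepData.hasLocalComponentAt_spherical_of_hasSatakeParamAt_holds π v β πv hβ hloc
  exact ⟨x₀, hx₀, mem_fixedPoints_glInt_of_forall_map_subtype πv.ρ hfix⟩

/-- `GL_n(𝒪_v)`-fixed vectors in the two senses coincide. [folklore] -/
theorem fixedPoints_glInt_eq_fixedPoints_valuedCongruenceSubgroup_one {v : HeightOneSpectrum (𝓞 K)}
    {V : Type*} [AddCommGroup V] [Module ℂ V]
    (ρ : Representation ℂ (GL (Fin n) (v.adicCompletion K)) V) :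
    ρ.fixedPoints (glInt n (v.adicCompletion K)) =
      ρ.fixedPoints (valuedCongruenceSubgroup (Fin n) (1 : WithZero (Multiplicative ℤ))) := by
  ext x
  simp only [Representation.mem_fixedPoints]
  exact ⟨fun h g hg => h g ((mem_glInt_iff_mem_valuedCongruenceSubgroup_one g).2 hg),
    fun h g hg => h g ((mem_glInt_iff_mem_valuedCongruenceSubgroup_one g).1 hg)⟩

/-- **Satake parameters of `π` at `v` are exactly the Satake parameters of a spherical local
component** (Flath 1979, Thm. 3; Borel–Jacquet 1979, §4.6; uniqueness: Cartier 1979, §IV.4).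
For a cuspidal `π` on `GL_n(𝔸_K)` (`n ≥ 1`, Borel–Jacquet datum) with irreducible smooth local
component `π_v` (an accepted `SmoothIrrep`) possessing a non-zero `GL_n(𝒪_v)`-fixed vector, and a
uniformiser `ϖ'` of `K_v`: `π.HasSatakeParamAt v β ↔ IsSatakeParameter π_v ϖ' β`.
(`→`: `CuspidalAutomorphicRepData.isSatakeParameter_of_hasLocalComponentAt`.  `←`: `π` is
unramified at `v` by `isUnramifiedAt_of_hasLocalComponentAt_of_mem_fixedPoints`; its Satake
parameter `β₀` is a local Satake parameter of `π_v` by `→`; and the local Satake parameter of the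
irreducible admissible (Jacquet, `jacquetAdmissibility_gl_holds`) spherical `π_v` is unique,
`SatakeParametersGL.existsUnique_isSatakeParameter_holds`.)
[cite: FlathCorvallis1979, Thm. 3] [cite: BorelJacquetCorvallis1979, §4.6] [cite: CartierCorvallis1979, §IV.4] -/
theorem hasSatakeParamAt_iff_isSatakeParameter_of_hasLocalComponentAt [NeZero n]
    (π : CuspidalAutomorphicRepData n K hcpt) (v : HeightOneSpectrum (𝓞 K))
    (πv : SmoothIrrep (GL (Fin n) (v.adicCompletion K))) (hloc : π.1.HasLocalComponentAt v πv.ρ)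
    {x₀ : πv.V} (hx₀ : x₀ ≠ 0) (hK₀ : x₀ ∈ πv.ρ.fixedPoints (glInt n (v.adicCompletion K)))
    {ϖ' : (v.adicCompletion K)ˣ}
    (hϖ' : (ValuativeRel.valuation (v.adicCompletion K)).IsUniformizer (ϖ' : v.adicCompletion K))
    (β : Multiset ℂ) :
    π.1.HasSatakeParamAt v β ↔ IsSatakeParameter πv.ρ ϖ' β := by
  haveI := πv.isIrreducible
  refine ⟨fun hβ => π.isSatakeParameter_of_hasLocalComponentAt v πv.ρ πv.isSmooth hloc hβ hϖ',
    fun hβ => ?_⟩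
  have hK₀' : x₀ ∈ πv.ρ.fixedPoints
      (valuedCongruenceSubgroup (Fin n) (1 : WithZero (Multiplicative ℤ))) := by
    rwa [← fixedPoints_glInt_eq_fixedPoints_valuedCongruenceSubgroup_one]
  obtain ⟨β₀, hβ₀⟩ := AutomorphicRepData.isUnramifiedAt_of_hasLocalComponentAt_of_mem_fixedPoints
    π.1 v πv hloc hx₀ hK₀'
  have hβ₀' : IsSatakeParameter πv.ρ ϖ' β₀ :=
    π.isSatakeParameter_of_hasLocalComponentAt v πv.ρ πv.isSmooth hloc hβ₀ hϖ'
  have hadm : πv.ρ.IsAdmissible :=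
    jacquetAdmissibility_gl_holds (v.adicCompletion K) n πv.V πv.ρ πv.isSmooth πv.isIrreducible
  have hunr : πv.ρ.IsUnramified (glInt n (v.adicCompletion K)) := by
    rw [Representation.isUnramified_iff, Submodule.ne_bot_iff]
    exact ⟨x₀, hK₀, hx₀⟩
  obtain ⟨α, -, huniq⟩ := SatakeParametersGL.existsUnique_isSatakeParameter_holds πv.ρ hadm hunr hϖ'
  rw [huniq β hβ, ← huniq β₀ hβ₀']
  exact hβ₀

/-- **An unramified `π` and any irreducible smooth local component: the Satake parameter exists
on both sides and is the same.**  If `π` is unramified at `v` (`IsUnramifiedAt`: some Satake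
parameter `β`) and `π_v` is an irreducible smooth local component, then for every uniformiser `ϖ'`,
`π.HasSatakeParamAt v β ∧ IsSatakeParameter π_v ϖ' β` for some `β` — in particular `π_v` is
spherical (a non-zero `GL_n(𝒪_v)`-fixed vector is part of `IsSatakeParameter`).
[cite: FlathCorvallis1979, Thm. 3] [cite: BorelJacquetCorvallis1979, §4.6] -/
theorem exists_hasSatakeParamAt_and_isSatakeParameter_of_isUnramifiedAt [NeZero n]
    (π : CuspidalAutomorphicRepData n K hcpt) (v : HeightOneSpectrum (𝓞 K))
    (hπ : π.1.IsUnramifiedAt v)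
    (πv : SmoothIrrep (GL (Fin n) (v.adicCompletion K))) (hloc : π.1.HasLocalComponentAt v πv.ρ)
    {ϖ' : (v.adicCompletion K)ˣ}
    (hϖ' : (ValuativeRel.valuation (v.adicCompletion K)).IsUniformizer (ϖ' : v.adicCompletion K)) :
    ∃ β : Multiset ℂ, π.1.HasSatakeParamAt v β ∧ IsSatakeParameter πv.ρ ϖ' β := by
  haveI := πv.isIrreducible
  obtain ⟨β, hβ⟩ := hπ
  exact ⟨β, hβ, π.isSatakeParameter_of_hasLocalComponentAt v πv.ρ πv.isSmooth hloc hβ hϖ'⟩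

/-- **Spherical local component ⟹ `π` unramified, `glInt` form** (Flath 1979, Thm. 3;
`isUnramifiedAt_of_hasLocalComponentAt_of_mem_fixedPoints` with the identification of the two
`GL_n(𝒪_v)`'s). [cite: FlathCorvallis1979, Thm. 3] -/
theorem isUnramifiedAt_of_hasLocalComponentAt_of_mem_fixedPoints_glInt
    (π : AutomorphicRepData (AutomorphyDatum.gl n K hcpt)) (v : HeightOneSpectrum (𝓞 K))
    (πv : SmoothIrrep (GL (Fin n) (v.adicCompletion K))) (hloc : π.HasLocalComponentAt v πv.ρ)
    {x₀ : πv.V} (hx₀ : x₀ ≠ 0) (hK₀ : x₀ ∈ πv.ρ.fixedPoints (glInt n (v.adicCompletion K))) :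
    π.IsUnramifiedAt v :=
  AutomorphicRepData.isUnramifiedAt_of_hasLocalComponentAt_of_mem_fixedPoints π v πv hloc hx₀
    (by rwa [← fixedPoints_glInt_eq_fixedPoints_valuedCongruenceSubgroup_one])

end Literature.NumberTheory.Automorphic

end
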